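import Mathlib.GroupTheory.Abelianization.Defs
import Mathlib.LinearAlgebra.Finsupp.LinearCombination
import Literature.Algebra.Lie.SurfaceGroupMagnus
import HarnessLib

/-!
# Labute's theorem: `gr(π₁Σ_g) ≅ 𝔰_g(ℤ)` — proof

Topic `Literature/Algebra/Lie`. This file discharges the named fact
`Literature.Algebra.Lie.Labute1970_grSurfaceGroup` (`Literature/Algebra/Lie/SurfaceLieAlgebra.lean`):
for `g ≥ 1` the Lie ring `gr(S_g) = ⊕ₙ γₙ/γₙ₊₁` of the lower central series of the surface group
`S_g = π₁(Σ_g)` is the surface Lie algebra `𝔰_g(ℤ) = L(aᵢ, bᵢ)/(∑ ⁅aᵢ, bᵢ⁆)`, compatibly with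
generators and brackets (Labute, J. Algebra 14 (1970), Theorem p. 17).

Assembly of the proof. The canonical morphism `Φ : 𝔰_g(ℤ) → gr(S_g)`
(`SurfaceGr.Phi`, `Literature/Algebra/Lie/SurfaceGroupGrLie.lean`) maps `𝔰_{n+1}` onto
`γₙ/γₙ₊₁` (`SurfaceGr.Phi_image_grade`) and is injective on `𝔰_{n+1}`: for `n + 1 ≥ 2` by the
Magnus representation (`SurfaceGr.Phi_eq_zero_imp`, `Literature/Algebra/Lie/SurfaceGroupMagnus.lean`),
and for `n + 1 = 1` by the abelianisation `S_g → ℤ` dual to each generator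
(`SurfaceGr.Phi_eq_zero_imp_one` below). The maps `θₙ : S_g → 𝔰_g(ℤ)` of the statement are then
`θₙ x = Φ⁻¹(toGr n x)` (`SurfaceGr.theta`), and the six clauses follow from the corresponding
properties of the symbol maps `toGr` (`Literature/GroupTheory/CombinatorialGroupTheory/LowerCentralSeriesLieRing.lean`).

Deviation from the printed proof: Labute (§3) embeds `gr(S_g)` into `gr` of the group ring filtered
by a weighted augmentation filtration and identifies the latter with `U(𝔰_g)` via his 1967 results
and Birkhoff–Witt; here the lower bound is obtained instead from an explicit truncated Magnus
module for `𝔰_g`'s elimination presentation, which needs only Witt's embedding theorem for free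
Lie rings (`Literature/Algebra/Lie/FreeLieRingEmbeddingGeneral.lean`).

Everything is proved; there are no named facts.

## References

* J. P. Labute, On the descending central series of groups with a single defining relation,
  J. Algebra 14 (1970) 16–23, Theorem (p. 17) and §3. [Labute1970]
-/

noncomputable section

namespace Literature.Algebra.Lie

namespace SurfaceGr

open SurfaceLieAlgebra
open Literature.GroupTheory.CombinatorialGroupTheory
open Literature.Topology.FourManifolds
open scoped commutatorElement

-- Mathlib idiom: the commutator bracket on an associative ring (here on `ℤ`, where it vanishes).
attribute [local instance 100] LieRing.ofAssociativeRing

variable (g : ℕ)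

/-! ## Degree one: the abelianisation -/

/-- The character `S_g → ℤ` (written multiplicatively) dual to the generator `x₀`. [folklore] -/
def dualHom (x₀ : Fin g × Bool) : SurfaceGroup g →* Multiplicative ℤ :=
  PresentedGroup.toGroup (f := fun y => Multiplicative.ofAdd (if y = x₀ then (1 : ℤ) else 0)) (by
    have hcomm : ∀ p q : Multiplicative ℤ, p * q * p⁻¹ * q⁻¹ = 1 := fun p q => by
      rw [mul_comm p q, mul_inv_cancel_right, mul_inv_cancel]
    intro r hr
    rw [Set.mem_singleton_iff.1 hr]
    unfold surfaceRelator
    rw [map_list_prod, List.map_map]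
    apply List.prod_eq_one
    intro u hu
    obtain ⟨i, -, rfl⟩ := List.mem_map.1 hu
    simp only [Function.comp_apply, map_mul, map_inv]
    exact hcomm _ _)

/-- `dualHom x₀` on generators. [folklore] -/
theorem dualHom_of (x₀ y : Fin g × Bool) :
    dualHom g x₀ (PresentedGroup.of y) = Multiplicative.ofAdd (if y = x₀ then (1 : ℤ) else 0) :=
  PresentedGroup.toGroup.of _

/-- `dualHom x₀` kills `γ₁ = [S_g, S_g]`. [folklore] -/
theorem dualHom_eq_one_of_mem (x₀ : Fin g × Bool) {x : SurfaceGroup g} (hx : x ∈ lcs (SurfaceGroup g) 1) :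
    dualHom g x₀ x = 1 := by
  have hx' : x ∈ commutator (SurfaceGroup g) := by rwa [← Subgroup.top_lowerCentralSeries_one]
  exact Abelianization.commutator_subset_ker (dualHom g x₀) hx'

/-- The data of the Lie ring morphism `gr(S_g) → ℤ` dual to `x₀`: the character in degree `0`, zero
above. [folklore] -/
def dualF (x₀ : Fin g × Bool) : ℕ → SurfaceGroup g → ℤ
  | 0, x => Multiplicative.toAdd (dualHom g x₀ x)
  | _ + 1, _ => 0

/-- `dualF` in degree `0` is the character. [folklore] -/
@[simp] theorem dualF_zero (x₀ : Fin g × Bool) (x : SurfaceGroup g) :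
    dualF g x₀ 0 x = Multiplicative.toAdd (dualHom g x₀ x) := rfl

/-- `dualF` vanishes in positive degrees. [folklore] -/
@[simp] theorem dualF_succ (x₀ : Fin g × Bool) (n : ℕ) (x : SurfaceGroup g) : dualF g x₀ (n + 1) x = 0 := rfl

/-- **The Lie ring morphism `gr(S_g) → ℤ` dual to the generator `x₀`.** [folklore] -/
def dualLie (x₀ : Fin g × Bool) : GrLCS (SurfaceGroup g) →ₗ⁅ℤ⁆ ℤ :=
  GrLCS.liftLie (dualF g x₀)
    (by
      rintro (_ | n) x - y -
      · rw [dualF_zero, dualF_zero, dualF_zero, map_mul, toAdd_mul]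
      · rw [dualF_succ, dualF_succ, dualF_succ, add_zero])
    (by
      rintro (_ | n) x hx
      · rw [dualF_zero, dualHom_eq_one_of_mem g x₀ hx, toAdd_one]
      · rfl)
    (by
      intro m n x _ y _
      rw [dualF_succ, LieRing.of_associative_ring_bracket, mul_comm, sub_self])

/-- `dualLie x₀ (Φ (gen y)) = δ_{x₀ y}`. [folklore] -/
theorem dualLie_Phi_gen (x₀ y : Fin g × Bool) :
    dualLie g x₀ (Phi g (gen ℤ g y)) = if y = x₀ then 1 else 0 := by
  rw [Phi_gen, dualLie, GrLCS.liftLie_toGr _ _ _ _ (Subgroup.mem_top _), dualF_zero, dualHom_of, toAdd_ofAdd]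

/-- **Injectivity of `Φ` in degree one**: the symbols of the generators are linearly independent in
`S_g^{ab} ≅ ℤ^{2g}`. [folklore] -/
theorem Phi_eq_zero_imp_one {u : SurfaceLieAlgebra ℤ g} (hu : u ∈ grade ℤ g 1) (h0 : Phi g u = 0) : u = 0 := by
  have hu' : u ∈ Submodule.span ℤ (Set.range (gen ℤ g)) := by
    have : grade ℤ g 1 = Submodule.span ℤ (Set.range (gen ℤ g)) := wordGrade_one _
    rw [← this]; exact hu
  obtain ⟨c, rfl⟩ := (Submodule.mem_span_range_iff_exists_fun ℤ).1 hu'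
  have hc : ∀ x₀, c x₀ = 0 := by
    intro x₀
    have h1 := congrArg (dualLie g x₀) h0
    rw [map_zero, map_sum, map_sum] at h1
    simp only [map_smul, dualLie_Phi_gen, smul_eq_mul, mul_ite, mul_one, mul_zero,
      Finset.sum_ite_eq', Finset.mem_univ, if_true] at h1
    exact h1
  simp [hc]

/-- **Injectivity of `Φ` on every piece** (`g ≥ 1`): `u ∈ 𝔰_{n+1}`, `Φ u = 0` ⟹ `u = 0`.
[cite: Labute1970, §1 Theorem] -/
theorem Phi_eq_zero_imp_succ (g : ℕ) {n : ℕ} {u : SurfaceLieAlgebra ℤ (g + 1)} (hu : u ∈ grade ℤ (g + 1) (n + 1))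
    (h0 : Phi (g + 1) u = 0) : u = 0 := by
  rcases n with _ | n
  · exact Phi_eq_zero_imp_one (g + 1) hu h0
  · exact Phi_eq_zero_imp (by omega) hu h0

/-- `Φ` separates the degree-`(n+1)` piece. [folklore] -/
theorem eq_of_Phi_eq (g : ℕ) {n : ℕ} {u v : SurfaceLieAlgebra ℤ (g + 1)} (hu : u ∈ grade ℤ (g + 1) (n + 1))
    (hv : v ∈ grade ℤ (g + 1) (n + 1)) (h : Phi (g + 1) u = Phi (g + 1) v) : u = v :=
  sub_eq_zero.1 (Phi_eq_zero_imp_succ g (sub_mem hu hv) (by rw [map_sub, h, sub_self]))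

/-! ## The maps `θₙ = Φ⁻¹ ∘ toGr n` -/

/-- Every symbol `toGr n x` has a (unique) preimage in `𝔰_{n+1}`. [folklore] -/
theorem exists_mem_grade_Phi_eq (g n : ℕ) (x : SurfaceGroup (g + 1)) :
    ∃ u, u ∈ grade ℤ (g + 1) (n + 1) ∧ Phi (g + 1) u = toGr (SurfaceGroup (g + 1)) n x := by
  by_cases hx : x ∈ lcs (SurfaceGroup (g + 1)) n
  · obtain ⟨u, hu, h⟩ := exists_Phi_eq_toGr (g + 1) n x hx
    exact ⟨u, hu, h⟩
  · exact ⟨0, zero_mem _, by rw [map_zero, toGr_of_not_mem hx]⟩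

/-- **`θₙ : S_{g+1} → 𝔰_{g+1}(ℤ)`**, `θₙ x = Φ⁻¹(toGr n x)` (and `0` off `γₙ`). [folklore] -/
def theta (g n : ℕ) (x : SurfaceGroup (g + 1)) : SurfaceLieAlgebra ℤ (g + 1) :=
  Classical.choose (exists_mem_grade_Phi_eq g n x)

/-- `θₙ x ∈ 𝔰_{n+1}`. [folklore] -/
theorem theta_mem (g n : ℕ) (x : SurfaceGroup (g + 1)) : theta g n x ∈ grade ℤ (g + 1) (n + 1) :=
  (Classical.choose_spec (exists_mem_grade_Phi_eq g n x)).1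

/-- `Φ (θₙ x) = toGr n x`. [folklore] -/
theorem Phi_theta (g n : ℕ) (x : SurfaceGroup (g + 1)) :
    Phi (g + 1) (theta g n x) = toGr (SurfaceGroup (g + 1)) n x :=
  (Classical.choose_spec (exists_mem_grade_Phi_eq g n x)).2

/-- Characterisation of `θₙ x`: the element of `𝔰_{n+1}` mapping to `toGr n x`. [folklore] -/
theorem theta_eq_of (g : ℕ) {n : ℕ} {x : SurfaceGroup (g + 1)} {u : SurfaceLieAlgebra ℤ (g + 1)}
    (hu : u ∈ grade ℤ (g + 1) (n + 1)) (h : Phi (g + 1) u = toGr (SurfaceGroup (g + 1)) n x) : theta g n x = u :=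
  eq_of_Phi_eq g (theta_mem g n x) hu (by rw [Phi_theta, h])

/-- (1) `θₙ` is a homomorphism on `γₙ`. [folklore] -/
theorem theta_mul (g : ℕ) {n : ℕ} {x y : SurfaceGroup (g + 1)} (hx : x ∈ lcs (SurfaceGroup (g + 1)) n)
    (hy : y ∈ lcs (SurfaceGroup (g + 1)) n) : theta g n (x * y) = theta g n x + theta g n y :=
  theta_eq_of g (add_mem (theta_mem g n x) (theta_mem g n y)) (by rw [map_add, Phi_theta, Phi_theta, toGr_mul hx hy])

/-- (2) `θₙ(γₙ) = 𝔰_{n+1}`. [folklore] -/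
theorem theta_image (g n : ℕ) :
    theta g n '' (lcs (SurfaceGroup (g + 1)) n : Set (SurfaceGroup (g + 1))) = grade ℤ (g + 1) (n + 1) := by
  ext u
  constructor
  · rintro ⟨x, -, rfl⟩
    exact theta_mem g n x
  · intro hu
    obtain ⟨x, hx, h⟩ := GrLCS.exists_toGr_of_mem_range (Phi_mem_range_of (g + 1) hu)
    exact ⟨x, hx, theta_eq_of g hu h⟩

/-- (3) `ker θₙ ∩ γₙ = γₙ₊₁`. [folklore] -/
theorem theta_eq_zero_iff (g : ℕ) {n : ℕ} {x : SurfaceGroup (g + 1)} (hx : x ∈ lcs (SurfaceGroup (g + 1)) n) :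
    theta g n x = 0 ↔ x ∈ lcs (SurfaceGroup (g + 1)) (n + 1) := by
  rw [← toGr_eq_zero_iff hx]
  constructor
  · intro h
    rw [← Phi_theta, h, map_zero]
  · intro h
    exact theta_eq_of g (zero_mem _) (by rw [map_zero, h])

/-- (4) `θ₀(aᵢ) = aᵢ`. [folklore] -/
theorem theta_a (g : ℕ) (i : Fin (g + 1)) : theta g 0 (SurfaceGroup.a i) = SurfaceLieAlgebra.a ℤ (g + 1) i :=
  theta_eq_of g (gen_mem_grade_one ℤ (g + 1) (i, false)) (Phi_gen (g + 1) (i, false))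

/-- (5) `θ₀(bᵢ) = bᵢ`. [folklore] -/
theorem theta_b (g : ℕ) (i : Fin (g + 1)) : theta g 0 (SurfaceGroup.b i) = SurfaceLieAlgebra.b ℤ (g + 1) i :=
  theta_eq_of g (gen_mem_grade_one ℤ (g + 1) (i, true)) (Phi_gen (g + 1) (i, true))

/-- (6) `θ` turns group commutators into Lie brackets. [folklore] -/
theorem theta_commutator (g : ℕ) {m n : ℕ} {x y : SurfaceGroup (g + 1)} (hx : x ∈ lcs (SurfaceGroup (g + 1)) m)
    (hy : y ∈ lcs (SurfaceGroup (g + 1)) n) : theta g (m + n + 1) ⁅x, y⁆ = ⁅theta g m x, theta g n y⁆ := by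
  refine theta_eq_of g ?_ ?_
  · have := lie_mem_grade (R := ℤ) (g := g + 1) (theta_mem g m x) (theta_mem g n y)
    rwa [show m + 1 + (n + 1) = m + n + 1 + 1 by omega] at this
  · rw [LieHom.map_lie, Phi_theta, Phi_theta, lie_toGr_toGr hx hy]

end SurfaceGr

open SurfaceGr in
/-- **Labute's theorem** (J. Algebra 14 (1970), Theorem p. 17): for `g ≥ 1` the graded Lie ring of
the lower central series of `π₁(Σ_g)` is the surface Lie algebra `𝔰_g(ℤ)`, compatibly with the
generators and with brackets/commutators. Discharge of `Labute1970_grSurfaceGroup`.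
[cite: Labute1970, §1 Theorem (p. 17)] -/
theorem Labute1970_grSurfaceGroup_holds : Labute1970_grSurfaceGroup := by
  intro g hg
  obtain ⟨g, rfl⟩ : ∃ g', g = g' + 1 := ⟨g - 1, by omega⟩
  refine ⟨theta g, ?_, ?_, ?_, ?_, ?_, ?_⟩
  · intro n x hx y hy
    exact theta_mul g hx hy
  · intro n
    exact theta_image g n
  · intro n x hx
    exact theta_eq_zero_iff g hx
  · intro i
    exact theta_a g i
  · intro i
    exact theta_b g i
  · intro m n x hx y hy
    exact theta_commutator g hx hy

end Literature.Algebra.Lie
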